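import Mathlib

/-!
# BFS witnesses — stub `stub_bfsWitness` of line `Sketch`, crux stmt-PneNP-2463 (`SolvableImpliesStableSection`)

Pure finite combinatorics behind the first-moment bound on clause-sharing components.

* Part (a) (`bw_partA`): for an arbitrary relation `R` on a finite type, if `u ≥ 1` distinct
  vertices are `R`-reachable from `a`, then breadth-first search from `a` enumerates `u` distinct
  vertices `f 0 = a, f 1, …, f (u-1)` together with a *monotone* parent map `p` such that every
  `f i` (`i ≠ 0`) is an `R`-successor of its parent `f (p i)` with `p i < i`.  The search is run on
  `ℕ`-indexed partial data (`bw_bfs_nat`, one step `bw_step`): at each step the new vertex is an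
  undiscovered successor of the *least* listed index having one (`Nat.find`); the invariant records,
  besides the obvious facts, the closure property "every index below a parent has all its successors
  already listed", which makes the parent sequence monotone.  A new vertex exists by counting
  (`bw_exists_new`) and the boundary-crossing lemma `bw_crossing`.
* Part (b) (`bw_card_monotone_le`): monotone self-maps of `Fin u` number at most `4 ^ u`: the map
  `p ↦ range (i ↦ p i + i) ⊆ Fin (2u)` is injective (`i ↦ p i + i` is strictly monotone and a strictly
  monotone map on a well-order is determined by its range, `StrictMono.range_inj`), and
  `Fin (2u)` has `2 ^ (2u) = 4 ^ u` subsets.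

Used by the line to bound the number of BFS witnesses `(f, p)` of a large component by `m^u · 4^u`.
-/

set_option linter.dupNamespace false

namespace Summit.PneNP.PneNP.Cruxes.SolvableImpliesStableSection.Sketch

open Finset
open scoped Classical

/-- Boundary crossing: an `R`-path from a vertex inside `S` to a vertex outside `S` contains an
edge `R x y` with `x ∈ S` and `y ∉ S` (induction on the path). -/
private theorem bw_crossing {V : Type*} {R : V → V → Prop} (S : Set V) {a w : V}
    (h : Relation.ReflTransGen R a w) (ha : a ∈ S) (hw : w ∉ S) :
    ∃ x ∈ S, ∃ y ∉ S, R x y := by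
  induction h with
  | refl => exact absurd ha hw
  | @tail b c _ hbc ih =>
    by_cases hb : b ∈ S
    · exact ⟨b, hb, c, hw, hbc⟩
    · exact ih hb

/-- Counting: if only `j < u` vertices `f 0, …, f (j-1)` have been listed, then one of the `u`
distinct vertices `e k` is not among them. -/
private theorem bw_exists_new {V : Type*} [DecidableEq V] {u : ℕ} (e : Fin u → V)
    (he : Function.Injective e) (f : ℕ → V) {j : ℕ} (hju : j < u) :
    ∃ k : Fin u, ∀ i < j, f i ≠ e k := by
  by_contra h
  push Not at h
  have hsub : (univ : Finset (Fin u)).image e ⊆ (range j).image f := by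
    intro x hx
    simp only [mem_image, mem_univ, true_and] at hx
    obtain ⟨k, rfl⟩ := hx
    obtain ⟨i, hi, hfi⟩ := h k
    exact mem_image.2 ⟨i, mem_range.2 hi, hfi⟩
  have h1 : ((univ : Finset (Fin u)).image e).card = u := by
    rw [card_image_of_injective _ he, card_univ, Fintype.card_fin]
  have h2 : ((range j).image f).card ≤ j := card_image_le.trans (card_range j).le
  have h3 := card_le_card hsub
  omega

/-- One step of breadth-first search on `ℕ`-indexed partial data.  The invariant for the first
`j` indices: `f 0 = a`, `p 0 = 0`, every listed vertex is reachable from `a`, `p` is monotone,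
`p i < i` and `R (f (p i)) (f i)` for `i ≠ 0`, `f` is injective, and *closure*: every index below a
parent `p i` has all its `R`-successors already listed.  Given the invariant at `1 ≤ j < u`, we
extend to `j + 1`: let `c` be the least listed index with an unlisted successor `w` (it exists by
`bw_exists_new` and `bw_crossing`), and append `w` with parent `c`.  Monotonicity of the new parent
map is exactly the closure property, and closure is preserved by minimality of `c`. -/
private theorem bw_step {V : Type*} [Fintype V] [DecidableEq V] (R : V → V → Prop) (a : V)
    (u : ℕ) (e : Fin u → V) (he : Function.Injective e)
    (hreach : ∀ i, Relation.ReflTransGen R a (e i)) (j : ℕ) (hj : 1 ≤ j) (hju : j < u)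
    (f : ℕ → V) (p : ℕ → ℕ) (h0 : f 0 = a) (hp0 : p 0 = 0)
    (hr : ∀ i < j, Relation.ReflTransGen R a (f i))
    (hmono : ∀ i₁ i₂, i₁ ≤ i₂ → i₂ < j → p i₁ ≤ p i₂)
    (hpar : ∀ i < j, i ≠ 0 → p i < i ∧ R (f (p i)) (f i))
    (hinj : ∀ i₁ < j, ∀ i₂ < j, f i₁ = f i₂ → i₁ = i₂)
    (hclos : ∀ i < j, ∀ l < p i, ∀ w, R (f l) w → ∃ i' < j, f i' = w) :
    ∃ f' : ℕ → V, ∃ p' : ℕ → ℕ,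
      f' 0 = a ∧ p' 0 = 0 ∧ (∀ i < j + 1, Relation.ReflTransGen R a (f' i)) ∧
      (∀ i₁ i₂, i₁ ≤ i₂ → i₂ < j + 1 → p' i₁ ≤ p' i₂) ∧
      (∀ i < j + 1, i ≠ 0 → p' i < i ∧ R (f' (p' i)) (f' i)) ∧
      (∀ i₁ < j + 1, ∀ i₂ < j + 1, f' i₁ = f' i₂ → i₁ = i₂) ∧
      (∀ i < j + 1, ∀ l < p' i, ∀ w, R (f' l) w → ∃ i' < j + 1, f' i' = w) := by
  -- an unlisted reachable vertex, then a boundary edge out of the listed set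
  obtain ⟨k, hk⟩ := bw_exists_new e he f hju
  obtain ⟨x, hx, y, hy, hxy⟩ := bw_crossing (R := R) {v | ∃ i < j, f i = v} (hreach k)
    ⟨0, by omega, h0⟩ (by rintro ⟨i, hi, hfi⟩; exact hk i hi hfi)
  obtain ⟨l₀, hl₀, rfl⟩ := hx
  have hex : ∃ l, l < j ∧ ∃ w, w ∉ {v | ∃ i < j, f i = v} ∧ R (f l) w := ⟨l₀, hl₀, y, hy, hxy⟩
  -- the least listed index `c` with an unlisted successor, and such a successor `w`
  obtain ⟨c, ⟨hcj, w, hw, hcw⟩, hmin0⟩ :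
      ∃ c, (c < j ∧ ∃ w, w ∉ {v | ∃ i < j, f i = v} ∧ R (f c) w) ∧
        ∀ l < c, ¬ (l < j ∧ ∃ w, w ∉ {v | ∃ i < j, f i = v} ∧ R (f l) w) :=
    ⟨Nat.find hex, Nat.find_spec hex, fun l hl => Nat.find_min hex hl⟩
  have hw' : ∀ i < j, f i ≠ w := fun i hi hfi => hw ⟨i, hi, hfi⟩
  have hmin : ∀ l < c, ∀ w', R (f l) w' → ∃ i < j, f i = w' := by
    intro l hl w' hRw'
    by_contra hne
    exact hmin0 l hl ⟨hl.trans hcj, w', hne, hRw'⟩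
  -- append `w` with parent `c`
  refine ⟨fun i => if i < j then f i else w, fun i => if i < j then p i else c, ?_, ?_, ?_, ?_,
    ?_, ?_, ?_⟩
  · simp only [if_pos (show 0 < j by omega), h0]
  · simp only [if_pos (show 0 < j by omega), hp0]
  · intro i _
    by_cases hij : i < j
    · simp only [if_pos hij]
      exact hr i hij
    · simp only [if_neg hij]
      exact (hr c hcj).tail hcw
  · intro i₁ i₂ h12 _
    by_cases h2j : i₂ < j
    · simp only [if_pos (h12.trans_lt h2j), if_pos h2j]
      exact hmono i₁ i₂ h12 h2j
    · simp only [if_neg h2j]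
      by_cases h1j : i₁ < j
      · simp only [if_pos h1j]
        by_contra hlt
        push Not at hlt
        obtain ⟨i', hi', hfi'⟩ := hclos i₁ h1j c hlt w hcw
        exact hw' i' hi' hfi'
      · simp only [if_neg h1j, le_refl]
  · intro i hi hi0
    by_cases hij : i < j
    · obtain ⟨hpi, hRi⟩ := hpar i hij hi0
      simp only [if_pos hij, if_pos (hpi.trans hij)]
      exact ⟨hpi, hRi⟩
    · simp only [if_neg hij, if_pos hcj]
      exact ⟨by omega, hcw⟩
  · intro i₁ h1 i₂ h2 heq
    by_cases h1j : i₁ < j <;> by_cases h2j : i₂ < j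
    · simp only [if_pos h1j, if_pos h2j] at heq
      exact hinj i₁ h1j i₂ h2j heq
    · simp only [if_pos h1j, if_neg h2j] at heq
      exact absurd heq (hw' i₁ h1j)
    · simp only [if_neg h1j, if_pos h2j] at heq
      exact absurd heq.symm (hw' i₂ h2j)
    · omega
  · intro i _ l hl w' hRw'
    by_cases hij : i < j
    · simp only [if_pos hij] at hl
      have hlj : l < j := by
        rcases Nat.eq_zero_or_pos i with rfl | hipos
        · rw [hp0] at hl
          exact absurd hl (Nat.not_lt_zero l)
        · exact hl.trans ((hpar i hij hipos.ne').1.trans hij)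
      simp only [if_pos hlj] at hRw'
      obtain ⟨i', hi', hfi'⟩ := hclos i hij l hl w' hRw'
      exact ⟨i', by omega, by simp only [if_pos hi', hfi']⟩
    · simp only [if_neg hij] at hl
      simp only [if_pos (hl.trans hcj)] at hRw'
      obtain ⟨i', hi', hfi'⟩ := hmin l hl w' hRw'
      exact ⟨i', by omega, by simp only [if_pos hi', hfi']⟩

/-- Breadth-first search run for `j` steps (`1 ≤ j ≤ u`): `ℕ`-indexed data `f`, `p` satisfying
the invariant of `bw_step` on the first `j` indices.  Induction on `j`; the base case `j = 1` is
`f ≡ a`, `p ≡ 0`. -/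
private theorem bw_bfs_nat {V : Type*} [Fintype V] [DecidableEq V] (R : V → V → Prop) (a : V)
    (u : ℕ) (e : Fin u → V) (he : Function.Injective e)
    (hreach : ∀ i, Relation.ReflTransGen R a (e i)) :
    ∀ j : ℕ, 1 ≤ j → j ≤ u → ∃ f : ℕ → V, ∃ p : ℕ → ℕ,
      f 0 = a ∧ p 0 = 0 ∧ (∀ i < j, Relation.ReflTransGen R a (f i)) ∧
      (∀ i₁ i₂, i₁ ≤ i₂ → i₂ < j → p i₁ ≤ p i₂) ∧
      (∀ i < j, i ≠ 0 → p i < i ∧ R (f (p i)) (f i)) ∧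
      (∀ i₁ < j, ∀ i₂ < j, f i₁ = f i₂ → i₁ = i₂) ∧
      (∀ i < j, ∀ l < p i, ∀ w, R (f l) w → ∃ i' < j, f i' = w) := by
  intro j
  induction j with
  | zero => intro h; exact absurd h (by omega)
  | succ j ih =>
    intro _ hju
    rcases Nat.eq_zero_or_pos j with rfl | hj
    · refine ⟨fun _ => a, fun _ => 0, rfl, rfl, fun _ _ => Relation.ReflTransGen.refl,
        fun _ _ _ _ => le_rfl, ?_, ?_, ?_⟩
      · intro i hi hi0
        omega
      · intro i₁ h1 i₂ h2 _
        omega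
      · intro i _ l hl
        exact absurd hl (Nat.not_lt_zero l)
    · obtain ⟨f, p, h0, hp0, hr, hmono, hpar, hinj, hclos⟩ := ih hj (by omega)
      exact bw_step R a u e he hreach j hj (by omega) f p h0 hp0 hr hmono hpar hinj hclos

/-- **Part (a).**  If `u ≥ 1` distinct vertices are `R`-reachable from `a`, breadth-first search
enumerates `u` distinct vertices `f` with `f 0 = a` and a monotone parent map `p` with `p i < i`
and `R (f (p i)) (f i)` for `i ≠ 0` (conversion of `bw_bfs_nat` at `j = u` to `Fin u`). -/
private theorem bw_partA {V : Type} [Fintype V] [DecidableEq V] (R : V → V → Prop) (a : V)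
    (u : ℕ) (hu : 1 ≤ u)
    (he : ∃ e : Fin u → V, Function.Injective e ∧ ∀ i, Relation.ReflTransGen R a (e i)) :
    ∃ f : Fin u → V, Function.Injective f ∧ f ⟨0, hu⟩ = a ∧
      ∃ p : Fin u → Fin u, Monotone p ∧ ∀ i : Fin u, (i : ℕ) ≠ 0 → p i < i ∧ R (f (p i)) (f i) := by
  obtain ⟨e, he, hreach⟩ := he
  obtain ⟨f, p, h0, hp0, -, hmono, hpar, hinj, -⟩ := bw_bfs_nat R a u e he hreach u hu le_rfl
  have hple : ∀ i < u, p i ≤ i := by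
    intro i hi
    rcases Nat.eq_zero_or_pos i with rfl | hpos
    · rw [hp0]
    · exact (hpar i hi hpos.ne').1.le
  refine ⟨fun i => f i, ?_, h0, fun i => ⟨p i, (hple i i.2).trans_lt i.2⟩, ?_, ?_⟩
  · intro i₁ i₂ h
    exact Fin.ext (hinj i₁ i₁.2 i₂ i₂.2 h)
  · intro i₁ i₂ h
    rw [Fin.le_def] at h
    change p i₁ ≤ p i₂
    exact hmono i₁ i₂ h i₂.2
  · intro i hi0
    obtain ⟨hpi, hRi⟩ := hpar i i.2 hi0
    exact ⟨hpi, hRi⟩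

/-- **Part (b).**  Monotone self-maps of `Fin u` number at most `4 ^ u`: `p ↦ range (i ↦ p i + i)`
is an injection into the subsets of `Fin (2u)` (`i ↦ p i + i` is strictly monotone, and strictly
monotone maps on a well-order are determined by their range), and there are `2 ^ (2u) = 4 ^ u`
such subsets. -/
private theorem bw_card_monotone_le (u : ℕ) :
    Fintype.card {p : Fin u → Fin u // Monotone p} ≤ 4 ^ u := by
  have hsm : ∀ p : {p : Fin u → Fin u // Monotone p},
      StrictMono (fun i : Fin u => (⟨(p.1 i : ℕ) + i, by omega⟩ : Fin (2 * u))) := by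
    intro p i₁ i₂ h
    have hm := p.2 h.le
    rw [Fin.le_def] at hm
    rw [Fin.lt_def] at h ⊢
    simp only
    omega
  let g : {p : Fin u → Fin u // Monotone p} → Set (Fin (2 * u)) :=
    fun p => Set.range (fun i : Fin u => (⟨(p.1 i : ℕ) + i, by omega⟩ : Fin (2 * u)))
  have hg : Function.Injective g := by
    intro p q hpq
    have h := ((hsm p).range_inj (hsm q)).1 hpq
    apply Subtype.ext
    funext i
    have hi := congrFun h i
    simp only [Fin.mk.injEq] at hi
    exact Fin.ext (by omega)
  calc Fintype.card {p : Fin u → Fin u // Monotone p}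
      ≤ Fintype.card (Set (Fin (2 * u))) := Fintype.card_le_of_injective g hg
    _ = 4 ^ u := by
      rw [Fintype.card_set, Fintype.card_fin, pow_mul]
      norm_num

/-- **Stub `stub_bfsWitness`.**  (a) BFS enumeration with monotone parents: if `u ≥ 1` distinct
vertices of a finite type are `R`-reachable from `a`, there are `u` distinct vertices
`f 0 = a, f 1, …` and a monotone `p : Fin u → Fin u` with `p i < i` and `R (f (p i)) (f i)` for all
`i ≠ 0` (breadth-first search, always expanding the least listed index with an unlisted successor).
(b) The number of monotone maps `Fin u → Fin u` is at most `4 ^ u` (injection into subsets of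
`Fin (2u)` via the strictly monotone `i ↦ p i + i`). -/
theorem stub_bfsWitness :
    (∀ {V : Type} [Fintype V] [DecidableEq V] (R : V → V → Prop) (a : V) (u : ℕ) (hu : 1 ≤ u),
      (∃ e : Fin u → V, Function.Injective e ∧ ∀ i, Relation.ReflTransGen R a (e i)) →
      ∃ f : Fin u → V, Function.Injective f ∧ f ⟨0, hu⟩ = a ∧
        ∃ p : Fin u → Fin u, Monotone p ∧ ∀ i : Fin u, (i : ℕ) ≠ 0 → p i < i ∧ R (f (p i)) (f i)) ∧
    ∀ u : ℕ, Fintype.card {p : Fin u → Fin u // Monotone p} ≤ 4 ^ u :=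
  ⟨fun R a u hu he => bw_partA R a u hu he, bw_card_monotone_le⟩

end Summit.PneNP.PneNP.Cruxes.SolvableImpliesStableSection.Sketch
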